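import Mathlib
import Summits.CriticalPhenomena.PercolationContinuityZ3.Theorems.PercNearOneGluingNoHeavyLowerTailPocketSizeGluing
import HarnessLib

/-!
# Crux `PercNearOneGluing.NoHeavyLowerTail` (stmt-CriticalPhenomena-4575), line `bhk-superadditivity-thinning` —
# POCKET-DEPTH GLUING: the exponent is the length of the longest positive path into the relay-free region

Lead prover-line-stmt-CriticalPhenomena-4575-c5-0, 2026-08-16.  Sharpening of the companion file
`…NoHeavyLowerTailPocketSizeGluing.lean` (same engine, same tools): the power `|F| + 1` of the pocket-size
gluing theorem is replaced by `L + 1`, where `L` bounds the number of FREE vertices on a positive-weight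
SIMPLE PATH starting at the observer block — the peeling of the block σ-recursion visits pairwise disjoint
blocks `O = B₀, B₁ ⊆ N(B₀), B₂ ⊆ N(B₁), …`, so it stops after at most `L` rounds.  Lands with
`--supports stmt-CriticalPhenomena-4575` (registered stub `pocketDepthGluing_block`).

## Statement (block form)

Weights `w` on the pairs of `Fin n`, observer block `O` contracted (`μ = prodBernoulli (glue w O)`), relay
set `A ∋ b` disjoint from `O`, free region `F` (disjoint from `O`, `A`) closed under positive-weight
non-relay adjacency from `O ∪ F`, and a number `L` such that
  (P_L)  for every `o ∈ O` and every duplicate-free list `l` of `L + 1` vertices of `F`, the vertex sequence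
         `o :: l` is NOT a positive-weight path (`¬ List.IsChain (w s(·,·) ≠ 0) (o :: l)`).
If `μ(a ↮ b) ≤ t` on `A` then `bad ^ (L + 1) ≤ t` and, for `L ≥ 1`, `bad ^ L · μ(O ↮ b) ≤ t`,
`bad := μ(O ↔ A) − μ(O ↔ b)`.
* `L = |F|` satisfies (P_L) trivially (pigeonhole), recovering pocket-size gluing.
* If the `A`-free region is an induced TREE rooted at `o`, (P_L) holds with `L` = its height: e.g. an
  observer with ANY number of private neighbours each carrying ANY number of private children has
  `bad ^ 3 ≤ max_a μ(a ↮ b)` — independent of the size of the pocket and of `|A|`.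
* In general `L` = the maximal number of free vertices on a positive simple path from `O`.

## Proof

Induction on `L`.  `L = 0`: (P_0) says no positive pair joins `O` to `F`, so with the closure the block is
star-attached and `bad ≤ t` (`pocketGlue_base`).  Step `L + 1`: as in the companion file — layer
decomposition, block-deleted deadness `c = max_a P_{kill w O}(a ↮ b)`, off-set transfer `c · u ≤ t` —
except that a non-empty positive layer `S` avoiding `A` now yields the sub-instance `(kill w O, S, F ∖ S)`
satisfying (P_L): a positive `kill w O`-path `o' :: l` from `o' ∈ S` with `l ⊆ F ∖ S` extends to the positive
`w`-path `o₀ :: o' :: l` with `o₀ ∈ O`, `w s(o₀, o') ≠ 0` (positivity of the layer), of `L + 2` free vertices,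
excluded by (P_{L+1}).  No new definitions.
-/

namespace Summit.CriticalPhenomena.PercolationContinuityZ3.Theorems

open MeasureTheory Set
open Literature.Probability.LatticeModels (prodBernoulli)
open Literature.Probability.Percolation (BondConfig openConn)

noncomputable section
open Classical

variable {n : ℕ}

/-! ### The step -/

/-- **Inductive step (depth form).**  For a contracted block `O` whose free region `F` (closed under
positive-weight non-relay adjacency from `O ∪ F`) contains no positive-weight simple path `o :: l` with
`o ∈ O` and `l` a duplicate-free list of `L + 2` vertices of `F`, granted the weak inequality
`bad' ^ (L + 1) ≤ t'` for every instance on the same vertex set without such paths of `L + 1` free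
vertices, one has the strong inequality `bad ^ (L + 1) · μ(O ↮ b) ≤ t`.  The sub-instance
`(kill w O, S, F ∖ S)` of a positive layer `S` inherits the path bound with `L + 1` in place of `L + 2`:
prepend to a path from `o' ∈ S` a vertex `o₀ ∈ O` with `w s(o₀, o') ≠ 0`. -/
theorem pocketDepth_step (L : ℕ) (w : Sym2 (Fin n) → unitInterval) (O F A : Finset (Fin n)) (b : Fin n)
    (t : ℝ) (hbA : b ∈ A) (hOA : Disjoint O A) (hFA : Disjoint F A)
    (hcl : ∀ x ∈ O ∪ F, ∀ y : Fin n, y ∉ O → y ∉ F → y ∉ A → w s(x, y) = 0)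
    (hpath : ∀ o ∈ O, ∀ l : List (Fin n), l.length = L + 2 → l.Nodup → (∀ x ∈ l, x ∈ F) →
      ¬ List.IsChain (fun x y : Fin n => w s(x, y) ≠ 0) (o :: l))
    (hrel : ∀ a ∈ A, (prodBernoulli (fun e : Sym2 (Fin n) =>
      if (∀ x ∈ e, x ∈ O) ∧ ¬ e.IsDiag then 1 else w e)).real (openConn a b)ᶜ ≤ t)
    (IH : ∀ (w' : Sym2 (Fin n) → unitInterval) (O' F' : Finset (Fin n)) (t' : ℝ),
      Disjoint O' A → Disjoint F' A → Disjoint O' F' →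
      (∀ x ∈ O' ∪ F', ∀ y : Fin n, y ∉ O' → y ∉ F' → y ∉ A → w' s(x, y) = 0) →
      (∀ o ∈ O', ∀ l : List (Fin n), l.length = L + 1 → l.Nodup → (∀ x ∈ l, x ∈ F') →
        ¬ List.IsChain (fun x y : Fin n => w' s(x, y) ≠ 0) (o :: l)) →
      (∀ a ∈ A, (prodBernoulli (fun e : Sym2 (Fin n) =>
        if (∀ x ∈ e, x ∈ O') ∧ ¬ e.IsDiag then 1 else w' e)).real (openConn a b)ᶜ ≤ t') →
      ((prodBernoulli (fun e : Sym2 (Fin n) =>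
          if (∀ x ∈ e, x ∈ O') ∧ ¬ e.IsDiag then 1 else w' e)).real (⋃ o ∈ O', ⋃ x ∈ A, openConn o x) -
        (prodBernoulli (fun e : Sym2 (Fin n) =>
          if (∀ x ∈ e, x ∈ O') ∧ ¬ e.IsDiag then 1 else w' e)).real (⋃ o ∈ O', openConn o b))
          ^ (L + 1) ≤ t') :
    ((prodBernoulli (fun e : Sym2 (Fin n) => if (∀ x ∈ e, x ∈ O) ∧ ¬ e.IsDiag then 1 else w e)).real
          (⋃ o ∈ O, ⋃ x ∈ A, openConn o x) -
        (prodBernoulli (fun e : Sym2 (Fin n) => if (∀ x ∈ e, x ∈ O) ∧ ¬ e.IsDiag then 1 else w e)).real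
          (⋃ o ∈ O, openConn o b)) ^ (L + 1) *
      (prodBernoulli (fun e : Sym2 (Fin n) => if (∀ x ∈ e, x ∈ O) ∧ ¬ e.IsDiag then 1 else w e)).real
        {ω : BondConfig (Fin n) | ∀ o ∈ O, ω ∉ openConn o b} ≤ t := by
  have hbO : b ∉ O := fun h => Finset.disjoint_left.1 hOA h hbA
  have hFc : L + 1 ≠ 0 := Nat.succ_ne_zero L
  -- names
  set g : Sym2 (Fin n) → unitInterval :=
    fun e => if (∀ x ∈ e, x ∈ O) ∧ ¬ e.IsDiag then 1 else w e with hg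
  set k : Sym2 (Fin n) → unitInterval := fun e => if (∃ x ∈ e, x ∈ O) then 0 else w e with hk
  set q : Finset (Fin n) → Sym2 (Fin n) → unitInterval := fun S e =>
    if (∀ x ∈ e, x ∈ S) ∧ ¬ e.IsDiag then 1 else if (∃ x ∈ e, x ∈ O) then 0 else w e with hq
  set ℓ : Finset (Fin n) → ℝ := fun S => (prodBernoulli g).real
    {ω : BondConfig (Fin n) | ∀ x : Fin n, x ∈ S ↔ (x ∉ O ∧ ∃ o ∈ O, s(o, x) ∈ ω)} with hℓ
  set α : Finset (Fin n) → ℝ := fun S => (prodBernoulli (q S)).real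
    (⋃ s ∈ S, ⋃ x ∈ A, openConn s x) with hα
  set β : Finset (Fin n) → ℝ := fun S => (prodBernoulli (q S)).real (⋃ s ∈ S, openConn s b) with hβ
  set d : Fin n → ℝ := fun a => (prodBernoulli k).real (openConn a b)ᶜ with hd
  -- the layer decomposition
  obtain ⟨hone, hpos, hAsum, hbsum, -⟩ := blockLayerDecomposition n w O A b b hOA hbO hbO
  change ∑ S : Finset (Fin n), ℓ S = 1 at hone
  change ∀ S : Finset (Fin n), ℓ S ≠ 0 → ∀ x ∈ S, x ∉ O ∧ ∃ o ∈ O, w s(o, x) ≠ 0 at hpos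
  change (prodBernoulli g).real (⋃ o ∈ O, ⋃ x ∈ A, openConn o x) =
    ∑ S : Finset (Fin n), ℓ S * α S at hAsum
  change (prodBernoulli g).real (⋃ o ∈ O, openConn o b) = ∑ S : Finset (Fin n), ℓ S * β S at hbsum
  -- the worst block-deleted deadness `c`
  obtain ⟨aM, haM, hmax⟩ := Finset.exists_max_image A d ⟨b, hbA⟩
  set c : ℝ := d aM with hc
  have hc0 : 0 ≤ c := measureReal_nonneg
  have haMO : aM ∉ O := fun h => Finset.disjoint_left.1 hOA h haM
  -- off-set transfer: `c · u ≤ μ(aM ↮ b) ≤ t`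
  have htrans : c * (prodBernoulli g).real {ω : BondConfig (Fin n) | ∀ o ∈ O, ω ∉ openConn o b} ≤ t :=
    le_trans (blockOffSetTransfer n w O aM b haMO hbO) (hrel aM haM)
  -- every sub-block has unreliabilities at most `c`
  have hsub : ∀ (S : Finset (Fin n)) (a : Fin n), a ∈ A →
      (prodBernoulli (q S)).real (openConn a b)ᶜ ≤ c :=
    fun S a ha => le_trans (pocketGlue_compl_mono w O S a b) (hmax a ha)
  -- termwise bounds
  have hterm : ∀ S : Finset (Fin n), ℓ S ≠ 0 → 0 ≤ α S - β S ∧ α S - β S ≤ 1 ∧ (α S - β S) ^ (L + 1) ≤ c := by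
    intro S hS0
    have hS := hpos S hS0
    have hβα : β S ≤ α S :=
      measureReal_mono (pocketGlue_reach_b_subset S A hbA) (measure_ne_top _ _)
    have hα1 : α S ≤ 1 := measureReal_le_one
    have hβ0 : 0 ≤ β S := measureReal_nonneg
    have h0 : 0 ≤ α S - β S := by linarith
    have h1 : α S - β S ≤ 1 := by linarith
    refine ⟨h0, h1, ?_⟩
    by_cases hSA : (S ∩ A).Nonempty
    · -- a layer meeting `A` at `v`: `bad'_S ≤ P'(v ↮ b) ≤ c`
      obtain ⟨v, hv⟩ := hSA
      rw [Finset.mem_inter] at hv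
      have hvb : 1 - β S ≤ (prodBernoulli (q S)).real (openConn v b)ᶜ := by
        rw [probReal_compl_eq_one_sub (pocketGlue_measurableSet _)]
        have : (prodBernoulli (q S)).real (openConn v b) ≤ β S :=
          measureReal_mono (fun ω hω => Set.mem_iUnion₂.2 ⟨v, hv.1, hω⟩) (measure_ne_top _ _)
        linarith
      have hle : α S - β S ≤ c := by linarith [hsub S v hv.2]
      exact le_trans (pow_le_of_le_one h0 h1 hFc) hle
    · have hSA' : Disjoint S A :=
        Finset.disjoint_iff_inter_eq_empty.2 (Finset.not_nonempty_iff_eq_empty.1 hSA)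
      by_cases hSe : S = ∅
      · -- the empty layer contributes nothing
        subst hSe
        have hα0 : α ∅ = 0 := by simp [hα]
        have hβ0' : β ∅ = 0 := by simp [hβ]
        rw [hα0, hβ0', sub_zero, zero_pow hFc]
        exact hc0
      · -- a non-empty layer avoiding `A`: it lies in `F`, recurse on `(kill w O, S, F \ S)`
        have hSF : S ⊆ F := by
          intro x hxS
          obtain ⟨hxO, o, ho, hw⟩ := hS x hxS
          by_contra hxF
          have hxA : x ∉ A := fun h => Finset.disjoint_left.1 hSA' hxS h
          exact hw (hcl o (Finset.mem_union_left F ho) x hxO hxF hxA)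
        have hFA' : Disjoint (F \ S) A := Finset.disjoint_of_subset_left Finset.sdiff_subset hFA
        have hSF' : Disjoint S (F \ S) := Finset.disjoint_sdiff
        have hcl' : ∀ x ∈ S ∪ (F \ S), ∀ y : Fin n, y ∉ S → y ∉ F \ S → y ∉ A → k s(x, y) = 0 := by
          intro x hx y hyS hyFS hyA
          simp only [hk]
          split_ifs with hxy
          · rfl
          · push Not at hxy
            have hxO : x ∉ O := fun h => hxy x (Sym2.mem_mk_left x y) h
            have hyO : y ∉ O := fun h => hxy y (Sym2.mem_mk_right x y) h
            have hxF : x ∈ F := by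
              rcases Finset.mem_union.1 hx with h | h
              · exact hSF h
              · exact (Finset.mem_sdiff.1 h).1
            have hyF : y ∉ F := fun h => hyFS (Finset.mem_sdiff.2 ⟨h, hyS⟩)
            exact hcl x (Finset.mem_union_right O hxF) y hyO hyF hyA
        -- the sub-instance has no positive simple path of `L + 1` vertices into `F \ S`
        have hpath' : ∀ o ∈ S, ∀ l : List (Fin n), l.length = L + 1 → l.Nodup → (∀ x ∈ l, x ∈ F \ S) →
            ¬ List.IsChain (fun x y : Fin n => k s(x, y) ≠ 0) (o :: l) := by
          intro o' ho' l hlen hnd hlF hch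
          obtain ⟨-, o₀, ho₀, hw₀⟩ := hS o' ho'
          have hkw : ∀ x y : Fin n, k s(x, y) ≠ 0 → w s(x, y) ≠ 0 := by
            intro x y hxy
            simp only [hk] at hxy
            split_ifs at hxy with h
            · exact absurd rfl hxy
            · exact hxy
          have hch' : List.IsChain (fun x y : Fin n => w s(x, y) ≠ 0) (o₀ :: o' :: l) := by
            rw [List.isChain_cons_cons]
            exact ⟨hw₀, hch.imp fun x y h => hkw x y h⟩
          refine hpath o₀ ho₀ (o' :: l) (by rw [List.length_cons, hlen]) ?_ ?_ hch'
          · rw [List.nodup_cons]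
            refine ⟨fun h => ?_, hnd⟩
            exact (Finset.mem_sdiff.1 (hlF o' h)).2 ho'
          · intro x hx
            rcases List.mem_cons.1 hx with rfl | h
            · exact hSF ho'
            · exact (Finset.mem_sdiff.1 (hlF x h)).1
        have hrel' : ∀ a ∈ A, (prodBernoulli (fun e : Sym2 (Fin n) =>
            if (∀ x ∈ e, x ∈ S) ∧ ¬ e.IsDiag then 1 else k e)).real (openConn a b)ᶜ ≤ c :=
          fun a ha => hsub S a ha
        exact IH k S (F \ S) c hSA' hFA' hSF' hcl' hpath' hrel'
  -- the largest term
  have hex : ∃ S ∈ (Finset.univ : Finset (Finset (Fin n))), ℓ S ≠ 0 := by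
    by_contra hcon
    push Not at hcon
    have : ∑ S : Finset (Fin n), ℓ S = 0 := Finset.sum_eq_zero fun S _ => hcon S (Finset.mem_univ _)
    rw [hone] at this
    exact one_ne_zero this
  obtain ⟨S₀, hS₀, hS₀max⟩ := Finset.exists_max_image
    ((Finset.univ : Finset (Finset (Fin n))).filter fun S => ℓ S ≠ 0) (fun S => α S - β S)
    (by obtain ⟨S, -, hS⟩ := hex; exact ⟨S, Finset.mem_filter.2 ⟨Finset.mem_univ _, hS⟩⟩)
  have hS₀ne : ℓ S₀ ≠ 0 := (Finset.mem_filter.1 hS₀).2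
  set γ : ℝ := α S₀ - β S₀ with hγ
  obtain ⟨hγ0, -, hγc⟩ := hterm S₀ hS₀ne
  -- `bad ≤ γ`
  have hbad_le : (prodBernoulli g).real (⋃ o ∈ O, ⋃ x ∈ A, openConn o x) -
      (prodBernoulli g).real (⋃ o ∈ O, openConn o b) ≤ γ := by
    rw [hAsum, hbsum, ← Finset.sum_sub_distrib]
    have heq : ∑ S : Finset (Fin n), (ℓ S * α S - ℓ S * β S) =
        ∑ S : Finset (Fin n), ℓ S * (α S - β S) :=
      Finset.sum_congr rfl fun S _ => by ring
    rw [heq]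
    refine pocketGlue_convex_le Finset.univ ℓ (fun S => α S - β S) γ
      (fun S _ => measureReal_nonneg) hone fun S _ hS => ?_
    exact hS₀max S (Finset.mem_filter.2 ⟨Finset.mem_univ _, hS⟩)
  have hbad0 : 0 ≤ (prodBernoulli g).real (⋃ o ∈ O, ⋃ x ∈ A, openConn o x) -
      (prodBernoulli g).real (⋃ o ∈ O, openConn o b) := by
    have := measureReal_mono (μ := prodBernoulli g) (pocketGlue_reach_b_subset O A hbA)
      (measure_ne_top _ _)
    linarith
  -- assemble
  have hpow : ((prodBernoulli g).real (⋃ o ∈ O, ⋃ x ∈ A, openConn o x) -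
      (prodBernoulli g).real (⋃ o ∈ O, openConn o b)) ^ (L + 1) ≤ c :=
    le_trans (pow_le_pow_left₀ hbad0 hbad_le (L + 1)) hγc
  calc ((prodBernoulli g).real (⋃ o ∈ O, ⋃ x ∈ A, openConn o x) -
          (prodBernoulli g).real (⋃ o ∈ O, openConn o b)) ^ (L + 1) *
        (prodBernoulli g).real {ω : BondConfig (Fin n) | ∀ o ∈ O, ω ∉ openConn o b}
      ≤ c * (prodBernoulli g).real {ω : BondConfig (Fin n) | ∀ o ∈ O, ω ∉ openConn o b} :=
        mul_le_mul_of_nonneg_right hpow measureReal_nonneg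
    _ ≤ t := htrans

/-! ### The registered statement -/

/-- **Pocket-depth gluing, block form** (registered stub `pocketDepthGluing_block` of crux
stmt-CriticalPhenomena-4575, line `bhk-superadditivity-thinning`).  For a contracted observer block `O`
(`glue w O`), a relay set `A ∋ b` disjoint from `O`, a free region `F` (disjoint from `O` and `A`) such that
every positive-weight pair leaving `O ∪ F` ends in `O ∪ F ∪ A`, and `L` such that no duplicate-free list of
`L + 1` vertices of `F` continues a vertex of `O` to a positive-weight path: if `μ(a ↮ b) ≤ t` for all `a ∈ A`
then `(μ(O ↔ A) − μ(O ↔ b)) ^ (L + 1) ≤ t`, and for `L ≥ 1` the stronger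
`(μ(O ↔ A) − μ(O ↔ b)) ^ L · μ(∀ o ∈ O, o ↮ b) ≤ t`.  Induction on `L` (`pocketGlue_base`,
`pocketDepth_step`). -/
theorem pocketDepthGluing_block : ∀ (n : ℕ) (w : Sym2 (Fin n) → unitInterval) (O F A : Finset (Fin n)) (b : Fin n) (t : ℝ) (L : ℕ), b ∈ A → Disjoint O A → Disjoint F A → Disjoint O F → (∀ x ∈ O ∪ F, ∀ y : Fin n, y ∉ O → y ∉ F → y ∉ A → w s(x, y) = 0) → (∀ o ∈ O, ∀ l : List (Fin n), l.length = L + 1 → l.Nodup → (∀ x ∈ l, x ∈ F) → ¬ List.IsChain (fun x y : Fin n => w s(x, y) ≠ 0) (o :: l)) → (∀ a ∈ A, (Literature.Probability.LatticeModels.prodBernoulli (fun e : Sym2 (Fin n) => if (∀ x ∈ e, x ∈ O) ∧ ¬ e.IsDiag then 1 else w e)).real (Literature.Probability.Percolation.openConn a b)ᶜ ≤ t) → ((Literature.Probability.LatticeModels.prodBernoulli (fun e : Sym2 (Fin n) => if (∀ x ∈ e, x ∈ O) ∧ ¬ e.IsDiag then 1 else w e)).real (⋃ o ∈ O, ⋃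 x ∈ A, Literature.Probability.Percolation.openConn o x) - (Literature.Probability.LatticeModels.prodBernoulli (fun e : Sym2 (Fin n) => if (∀ x ∈ e, x ∈ O) ∧ ¬ e.IsDiag then 1 else w e)).real (⋃ o ∈ O, Literature.Probability.Percolation.openConn o b)) ^ (L + 1) ≤ t ∧ (1 ≤ L → ((Literature.Probability.LatticeModels.prodBernoulli (fun e : Sym2 (Fin n) => if (∀ x ∈ e, x ∈ O) ∧ ¬ e.IsDiag then 1 else w e)).real (⋃ o ∈ O, ⋃ x ∈ A, Literature.Probability.Percolation.openConn o x) - (Literature.Probability.LatticeModels.prodBernoulli (fun e : Sym2 (Fin n) => if (∀ x ∈ e, x ∈ O) ∧ ¬ e.IsDiag then 1 else w e)).real (⋃ o ∈ O, Literature.Probability.Percolation.openConn o b)) ^ L * (Literature.Probability.LatticeModels.prodBernoulli (fun e : Sym2 (Fin n) => if (∀ x ∈ e, x ∈ O) ∧ ¬ e.IsDiag then 1 else w e)).real {ω : Literature.Probability.Percolation.BondConfig (Fin n) | ∀ o ∈ O, ω ∉ Literature.Probability.Percolation.openConn o b} ≤ t) := by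
  intro n w O F A b t L hbA hOA hFA hOF hcl hpath hrel
  -- induction on `L`, for all blocks / weights / free regions / slacks on the same vertex set
  induction L generalizing w O F t with
  | zero =>
    refine ⟨?_, fun h => absurd h (by norm_num)⟩
    rw [zero_add, pow_one]
    refine pocketGlue_base w O A b t hbA hOA (fun x hx y hyO hyA => ?_) hrel
    by_cases hyF : y ∈ F
    · -- a positive pair from `O` into `F` would be a positive path of one free vertex
      by_contra hw
      refine hpath x hx [y] rfl (List.nodup_singleton y) (fun z hz => ?_) ?_
      · rw [List.mem_singleton.1 hz]; exact hyF
      · exact List.isChain_pair.2 hw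
    · exact hcl x (Finset.mem_union_left F hx) y hyO hyF hyA
  | succ L IHL =>
    have hbO : b ∉ O := fun h => Finset.disjoint_left.1 hOA h hbA
    have hstrong := pocketDepth_step L w O F A b t hbA hOA hFA hcl hpath hrel
      (fun w' O' F' t' hO'A hF'A hO'F' hcl' hpath' hrel' =>
        (IHL w' O' F' t' hO'A hF'A hO'F' hcl' hpath' hrel').1)
    refine ⟨?_, fun _ => hstrong⟩
    -- `bad ≤ u`
    have hbad_le_u : (prodBernoulli (fun e : Sym2 (Fin n) =>
          if (∀ x ∈ e, x ∈ O) ∧ ¬ e.IsDiag then 1 else w e)).real (⋃ o ∈ O, ⋃ x ∈ A, openConn o x) -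
        (prodBernoulli (fun e : Sym2 (Fin n) =>
          if (∀ x ∈ e, x ∈ O) ∧ ¬ e.IsDiag then 1 else w e)).real (⋃ o ∈ O, openConn o b) ≤
        (prodBernoulli (fun e : Sym2 (Fin n) => if (∀ x ∈ e, x ∈ O) ∧ ¬ e.IsDiag then 1 else w e)).real
          {ω : BondConfig (Fin n) | ∀ o ∈ O, ω ∉ openConn o b} := by
      rw [pocketGlue_forall_notMem_eq, probReal_compl_eq_one_sub (pocketGlue_measurableSet _)]
      linarith [measureReal_le_one (μ := prodBernoulli (fun e : Sym2 (Fin n) =>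
        if (∀ x ∈ e, x ∈ O) ∧ ¬ e.IsDiag then 1 else w e)) (s := ⋃ o ∈ O, ⋃ x ∈ A, openConn o x)]
    have hbad0 : 0 ≤ (prodBernoulli (fun e : Sym2 (Fin n) =>
          if (∀ x ∈ e, x ∈ O) ∧ ¬ e.IsDiag then 1 else w e)).real (⋃ o ∈ O, ⋃ x ∈ A, openConn o x) -
        (prodBernoulli (fun e : Sym2 (Fin n) =>
          if (∀ x ∈ e, x ∈ O) ∧ ¬ e.IsDiag then 1 else w e)).real (⋃ o ∈ O, openConn o b) := by
      have := measureReal_mono (μ := prodBernoulli (fun e : Sym2 (Fin n) =>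
        if (∀ x ∈ e, x ∈ O) ∧ ¬ e.IsDiag then 1 else w e)) (pocketGlue_reach_b_subset O A hbA)
        (measure_ne_top _ _)
      linarith
    rw [pow_succ]
    exact le_trans (mul_le_mul_of_nonneg_left hbad_le_u (pow_nonneg hbad0 _)) hstrong

end

end Summit.CriticalPhenomena.PercolationContinuityZ3.Theorems
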